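import Literature.Geometry.Lorentzian.InitialDataInterpolation
import Literature.Geometry.Lorentzian.InteriorKerrGluingProofs
import Literature.Geometry.Lorentzian.KerrCylinderDatum
import HarnessLib

/-!
# Li–Mei 2020, Prop. 4.1, Step 1: the glued datum before the Corvino–Schoen deformation

Support file (all results proved; no named facts) for the named fact `LiMei.interiorKerrGluing`
(`InteriorKerrGluing.lean`; J. Li, H. Mei, *A construction of collapsing spacetimes in vacuum*,
Comm. Math. Phys. 378 (2020) = arXiv:2005.01249, Prop. 4.1). The printed proof (p. 22) begins:
"Let `φ` be a cut-off function … `(g̃, π̃) = (φ ḡ + (1 − φ) ḡ_{m,a⃗}, φ π̄ + (1 − φ) π̄_{m,a⃗})`.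
Then `(g̃, π̃) = (ḡ, π̄)` near `t₁`, `= (ḡ_{m,a⃗}, π̄_{m,a⃗})` near `t₂`, and
`‖(g̃ − ḡ_{m₀}, π̃ − π̄_{m₀})‖_{C^k} ≤ C ε`." In the tree's transport (radial variable `‖y‖` on `E3`,
annulus `A = {ρ₁ < ‖y‖ < ρ₂}`, module docstring of `InteriorKerrGluing.lean`) this file proves exactly
that step, with the Kerr end supplied by the global exact Kerr-cylinder datum
`LiMei.kerrCylinderDatum` (`KerrCylinderDatum.lean`) and the interpolation by
`InitialDataSet.interpolate` with the radial cut-off `radialCutoff σ₁ σ₂`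
(`InitialDataInterpolation.lean`):

* `IsVacuumOn.mono/.congr`, `IsKerrCylinderOn.mono/.congr`, `NearSchwarzschildCylinder.of_le/.congr`
  — the predicates of the fact are monotone and depend only on the sections on the relevant set
  (locality of the constraints, Bartnik–Isenberg 2004, §2; germs of iterated derivatives);
* `nearSchwarzschildCylinder_interpolate` — **`C^k`-closeness passes to interpolants**: if `D₁`, `D₂`
  are `ε`-close in `C^k` on `A` to the Schwarzschild cylinder and `‖∂ʲφ‖ ≤ C` on `A` (`j ≤ k`), the
  interpolant is `2ᵏ(2C + 1) ε`-close (Leibniz, `norm_iteratedFDeriv_cutoff_interpolate_sub_le`);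
* `preGluedDatum` — **the glued datum `D̃ = φ D + (1 − φ) D_{Kerr(m,a)}`** with
  `φ = radialCutoff σ₁ σ₂`: it is `D` on `{‖y‖ ≤ σ₁}` and the Kerr-cylinder datum on `{σ₂ ≤ ‖y‖}`
  (`preGluedDatum_h_inner_of_norm_le`, …), hence exactly the Kerr cylinder there
  (`isKerrCylinderOn_preGluedDatum`), vacuum wherever `D` is vacuum inside `{‖y‖ < σ₁}` and vacuum on
  `{σ₂ < ‖y‖}` (`isVacuumOn_preGluedDatum_of_norm_lt/_of_lt_norm`), and `Cε`-close to the
  Schwarzschild cylinder on `A` when `D` and the Kerr datum are `ε`-close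
  (`nearSchwarzschildCylinder_preGluedDatum`, `C` depending only on `σ₁, σ₂, ρ₁, ρ₂, k`).

* `conclusion_of_deformation` — **assembly**: if a datum `D'` agrees with `D̃` off a closed middle
  shell and is vacuum on an open middle shell, then `D'` satisfies the last three clauses of the
  conclusion of the fact (`= D` on the inner ball, vacuum on `A`, exactly Kerr on the outer shell).

What remains of the printed proof after this step is to produce such a `D'`: the deformation on the
middle annulus (Corvino–Schoen local deformation modulo the cokernel, the KID analysis and the
degree argument, pp. 23–25).

## References

* J. Li, H. Mei, *A construction of collapsing spacetimes in vacuum*, Comm. Math. Phys. 378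
  (2020), arXiv:2005.01249, proof of Prop. 4.1, p. 22 (key `LiMei2020`).
* R. Bartnik, J. Isenberg, *The constraint equations* (2004), §2 (key `BartnikIsenberg2004`).
-/

noncomputable section

open Bundle Set Function Filter Manifold TopologicalSpace
open scoped Manifold ContDiff Topology RealInnerProductSpace

namespace Literature.Geometry.Lorentzian

namespace LiMei

/-! ### Monotonicity and locality of `IsVacuumOn` -/

/-- `IsVacuumOn` is monotone in the set. [folklore] -/
theorem IsVacuumOn.mono {s t : Set E3} (hst : s ⊆ t) {D : InitialDataSet (𝓡 3) E3}
    (h : IsVacuumOn t D) : IsVacuumOn s D := by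
  intro _ y hy
  exact h y (hst hy)

/-- `IsVacuumOn` is additive in the set. [folklore] -/
theorem IsVacuumOn.union {s t : Set E3} {D : InitialDataSet (𝓡 3) E3} (hs : IsVacuumOn s D)
    (ht : IsVacuumOn t D) : IsVacuumOn (s ∪ t) D := by
  intro _ y hy
  rcases hy with hy | hy
  exacts [hs y hy, ht y hy]

/-- **Locality of the vacuum constraints**: if two data sets have the same sections on an OPEN set
`s` and one solves the vacuum constraints on `s`, so does the other
(`hamiltonianConstraintFn_congr`, `momentumConstraintFn_congr`). Bartnik–Isenberg 2004, §2.
[cite: BartnikIsenberg2004, §2] -/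
theorem IsVacuumOn.congr {s : Set E3} (hs : IsOpen s) {D D' : InitialDataSet (𝓡 3) E3}
    (hh : ∀ y ∈ s, D'.h.inner y = D.h.inner y) (hk : ∀ y ∈ s, D'.k y = D.k y)
    (h : IsVacuumOn s D) : IsVacuumOn s D' := by
  intro _ y hy
  haveI : D.metric.HasLeviCivita := PseudoRiemannianMetric.hasLeviCivita _
  have hev : ∀ᶠ z in 𝓝 y, z ∈ s := hs.mem_nhds hy
  obtain ⟨hH, hM⟩ := h y hy
  exact ⟨(InitialDataSet.hamiltonianConstraintFn_congr (hev.mono fun z hz ↦ hh z hz)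
      (hev.mono fun z hz ↦ hk z hz)).trans hH,
    (InitialDataSet.momentumConstraintFn_congr (hev.mono fun z hz ↦ hh z hz)
      (hev.mono fun z hz ↦ hk z hz)).trans hM⟩

/-! ### Smoothness of the components -/

/-- The components `z ↦ h_z(v, w)` of the metric of a datum on `E3` are smooth. [folklore] -/
theorem contDiff_h_inner_apply (D : InitialDataSet (𝓡 3) E3) (v w : E3) :
    ContDiff ℝ ∞ fun z : E3 ↦ D.h.inner z v w :=
  (D.contMDiff_coordH.contDiff.clm_apply contDiff_const).clm_apply contDiff_const

/-- The components `z ↦ k_z(v, w)` of a datum on `E3` are smooth. [folklore] -/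
theorem contDiff_k_apply (D : InitialDataSet (𝓡 3) E3) (v w : E3) :
    ContDiff ℝ ∞ fun z : E3 ↦ D.k z v w :=
  (D.contMDiff_coordK.contDiff.clm_apply contDiff_const).clm_apply contDiff_const

/-- The components of the Schwarzschild cylinder metric `ḡ` (Li–Mei (4.1), `gbarRep`) are smooth
off the origin. [cite: LiMei2020, (4.1)] -/
theorem contDiffAt_gbarRep_apply (M r₀ : ℝ) {y : E3} (hy : y ≠ 0) (v w : E3) {n : ℕ∞ω} :
    ContDiffAt ℝ n (fun z ↦ gbarRep M r₀ z v w) y := by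
  have h1 : ContDiffAt ℝ n (fun z : E3 ↦ ⟪z, v⟫) y := contDiffAt_id.inner ℝ contDiffAt_const
  have h2 : ContDiffAt ℝ n (fun z : E3 ↦ ⟪z, w⟫) y := contDiffAt_id.inner ℝ contDiffAt_const
  have h3 : ContDiffAt ℝ n (fun z : E3 ↦ ‖z‖ ^ 2) y := contDiffAt_id.norm_sq ℝ
  have hne : ‖y‖ ^ 2 ≠ 0 := pow_ne_zero 2 (norm_ne_zero_iff.2 hy)
  have hq : ContDiffAt ℝ n (fun z : E3 ↦ ⟪z, v⟫ * ⟪z, w⟫ / ‖z‖ ^ 2) y := (h1.mul h2).div h3 hne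
  exact (contDiffAt_const.mul hq).add ((contDiffAt_const.div h3 hne).mul (contDiffAt_const.sub hq))

/-- The components of the Schwarzschild cylinder tensor `k̄` (Li–Mei (4.1), `kbarRep`) are smooth
off the origin. [cite: LiMei2020, (4.1)] -/
theorem contDiffAt_kbarRep_apply (M r₀ : ℝ) {y : E3} (hy : y ≠ 0) (v w : E3) {n : ℕ∞ω} :
    ContDiffAt ℝ n (fun z ↦ kbarRep M r₀ z v w) y := by
  have h1 : ContDiffAt ℝ n (fun z : E3 ↦ ⟪z, v⟫) y := contDiffAt_id.inner ℝ contDiffAt_const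
  have h2 : ContDiffAt ℝ n (fun z : E3 ↦ ⟪z, w⟫) y := contDiffAt_id.inner ℝ contDiffAt_const
  have h3 : ContDiffAt ℝ n (fun z : E3 ↦ ‖z‖ ^ 2) y := contDiffAt_id.norm_sq ℝ
  have hne : ‖y‖ ^ 2 ≠ 0 := pow_ne_zero 2 (norm_ne_zero_iff.2 hy)
  have hq : ContDiffAt ℝ n (fun z : E3 ↦ ⟪z, v⟫ * ⟪z, w⟫ / ‖z‖ ^ 2) y := (h1.mul h2).div h3 hne
  exact (contDiffAt_const.mul hq).sub ((contDiffAt_const.div h3 hne).mul (contDiffAt_const.sub hq))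

variable [Kerr.Facts]

/-! ### Monotonicity and locality of `IsKerrCylinderOn` -/

/-- `IsKerrCylinderOn` is monotone in the set. [folklore] -/
theorem IsKerrCylinderOn.mono {m a r₀ τ₀ : ℝ} {R : E3 →ₗᵢ[ℝ] E3} {s t : Set E3} (hst : s ⊆ t)
    {D : InitialDataSet (𝓡 3) E3} (h : IsKerrCylinderOn m a r₀ τ₀ R t D) :
    IsKerrCylinderOn m a r₀ τ₀ R s D := by
  obtain ⟨r₁, hm, ψ, ν, hr, hψ, himm, hν, hh, hk⟩ := h
  exact ⟨r₁, hm, ψ, ν, hr, hψ, himm, hν, fun y hy ↦ hh y (hst hy), fun y hy ↦ hk y (hst hy)⟩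

/-- `IsKerrCylinderOn … s` depends only on the sections on `s`. [folklore] -/
theorem IsKerrCylinderOn.congr {m a r₀ τ₀ : ℝ} {R : E3 →ₗᵢ[ℝ] E3} {s : Set E3}
    {D D' : InitialDataSet (𝓡 3) E3} (hh' : ∀ y ∈ s, D'.h.inner y = D.h.inner y)
    (hk' : ∀ y ∈ s, D'.k y = D.k y) (h : IsKerrCylinderOn m a r₀ τ₀ R s D) :
    IsKerrCylinderOn m a r₀ τ₀ R s D' := by
  obtain ⟨r₁, hm, ψ, ν, hr, hψ, himm, hν, hh, hk⟩ := h
  refine ⟨r₁, hm, ψ, ν, hr, hψ, himm, hν, fun y hy ↦ (hh' y hy).trans (hh y hy), fun y hy ↦ ?_⟩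
  rw [hk' y hy]
  exact hk y hy

/-! ### Monotonicity and locality of `NearSchwarzschildCylinder` -/

/-- `NearSchwarzschildCylinder … k ε D` is monotone in `ε`. [folklore] -/
theorem NearSchwarzschildCylinder.of_le {M r₁ r₀ ρ₁ ρ₂ : ℝ} {k : ℕ} {ε ε' : ℝ} (hr₁ : r₁ < r₀)
    (hr₀ : 0 < r₀) (h2M : r₀ < 2 * M) (hρ₁ : 1 ≤ ρ₁) (hε : ε ≤ ε') {D : InitialDataSet (𝓡 3) E3}
    (h : NearSchwarzschildCylinder M r₁ r₀ ρ₁ ρ₂ k ε D) :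
    NearSchwarzschildCylinder M r₁ r₀ ρ₁ ρ₂ k ε' D := by
  rw [nearSchwarzschildCylinder_iff hr₁ hr₀ h2M hρ₁] at h ⊢
  exact fun v w hv hw i hi y hy₁ hy₂ ↦
    ⟨(h v w hv hw i hi y hy₁ hy₂).1.trans hε, (h v w hv hw i hi y hy₁ hy₂).2.trans hε⟩

/-- **`NearSchwarzschildCylinder` depends only on the sections on the annulus** (the iterated
derivatives at a point of the open annulus only see the germ, `Filter.EventuallyEq.iteratedFDeriv`).
[folklore] -/
theorem NearSchwarzschildCylinder.congr {M r₁ r₀ ρ₁ ρ₂ : ℝ} {k : ℕ} {ε : ℝ} (hr₁ : r₁ < r₀)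
    (hr₀ : 0 < r₀) (h2M : r₀ < 2 * M) (hρ₁ : 1 ≤ ρ₁) {D D' : InitialDataSet (𝓡 3) E3}
    (hh : ∀ y : E3, ρ₁ < ‖y‖ → ‖y‖ < ρ₂ → D'.h.inner y = D.h.inner y)
    (hk : ∀ y : E3, ρ₁ < ‖y‖ → ‖y‖ < ρ₂ → D'.k y = D.k y)
    (h : NearSchwarzschildCylinder M r₁ r₀ ρ₁ ρ₂ k ε D) :
    NearSchwarzschildCylinder M r₁ r₀ ρ₁ ρ₂ k ε D' := by
  rw [nearSchwarzschildCylinder_iff hr₁ hr₀ h2M hρ₁] at h ⊢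
  intro v w hv hw i hi y hy₁ hy₂
  have hA : IsOpen {z : E3 | ρ₁ < ‖z‖ ∧ ‖z‖ < ρ₂} :=
    (isOpen_lt continuous_const continuous_norm).inter (isOpen_lt continuous_norm continuous_const)
  have hev : ∀ᶠ z in 𝓝 y, ρ₁ < ‖z‖ ∧ ‖z‖ < ρ₂ := hA.mem_nhds ⟨hy₁, hy₂⟩
  have e1 : (fun z : E3 ↦ D'.h.inner z v w - gbarRep M r₀ z v w) =ᶠ[𝓝 y]
      fun z : E3 ↦ D.h.inner z v w - gbarRep M r₀ z v w :=
    hev.mono fun z hz ↦ by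
      show D'.h.inner z v w - gbarRep M r₀ z v w = D.h.inner z v w - gbarRep M r₀ z v w
      rw [hh z hz.1 hz.2]
  have e2 : (fun z : E3 ↦ D'.k z v w - kbarRep M r₀ z v w) =ᶠ[𝓝 y]
      fun z : E3 ↦ D.k z v w - kbarRep M r₀ z v w :=
    hev.mono fun z hz ↦ by
      show D'.k z v w - kbarRep M r₀ z v w = D.k z v w - kbarRep M r₀ z v w
      rw [hk z hz.1 hz.2]
  rw [(e1.iteratedFDeriv (𝕜 := ℝ) i).eq_of_nhds, (e2.iteratedFDeriv (𝕜 := ℝ) i).eq_of_nhds]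
  exact h v w hv hw i hi y hy₁ hy₂

/-! ### `C^k`-closeness passes to interpolants -/

/-- **`C^k`-closeness to the Schwarzschild cylinder passes to cut-off interpolants** (the estimate
"`‖(g̃ − ḡ_{m₀}, π̃ − π̄_{m₀})‖ ≤ Cε`" of Li–Mei, p. 22): if `D₁` and `D₂` are `ε`-close in sup-`C^k`
on the annulus `A = {ρ₁ < ‖y‖ < ρ₂}` (`ρ₁ ≥ 1`) to the Schwarzschild(`M`) cylinder `{r = r₀}`
(`NearSchwarzschildCylinder`), and the smooth cut-off `φ : E3 → [0, 1]` has `‖∂ʲφ‖ ≤ C` on `A` for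
`j ≤ k`, then `φ D₁ + (1 − φ) D₂` is `2ᵏ(2C + 1)ε`-close (componentwise Leibniz bound
`norm_iteratedFDeriv_cutoff_interpolate_sub_le` in the closed-form description
`nearSchwarzschildCylinder_iff`). [cite: LiMei2020, proof of Prop. 4.1, p. 22] -/
theorem nearSchwarzschildCylinder_interpolate {M r₁ r₀ ρ₁ ρ₂ : ℝ} {k : ℕ} {ε C : ℝ}
    (hr₁ : r₁ < r₀) (hr₀ : 0 < r₀) (h2M : r₀ < 2 * M) (hρ₁ : 1 ≤ ρ₁) {φ : E3 → ℝ}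
    (hφ : ContDiff ℝ ∞ φ) (h01 : ∀ y, 0 ≤ φ y ∧ φ y ≤ 1)
    (hC : ∀ j ≤ k, ∀ y : E3, ρ₁ < ‖y‖ → ‖y‖ < ρ₂ → ‖iteratedFDeriv ℝ j φ y‖ ≤ C)
    {D₁ D₂ : InitialDataSet (𝓡 3) E3} (hD₁ : NearSchwarzschildCylinder M r₁ r₀ ρ₁ ρ₂ k ε D₁)
    (hD₂ : NearSchwarzschildCylinder M r₁ r₀ ρ₁ ρ₂ k ε D₂) :
    NearSchwarzschildCylinder M r₁ r₀ ρ₁ ρ₂ k (2 ^ k * (2 * C + 1) * ε)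
      (D₁.interpolate D₂ hφ h01) := by
  rw [nearSchwarzschildCylinder_iff hr₁ hr₀ h2M hρ₁] at hD₁ hD₂ ⊢
  intro v w hv hw i hi y hy₁ hy₂
  have hs : IsOpen {z : E3 | ρ₁ < ‖z‖ ∧ ‖z‖ < ρ₂} :=
    (isOpen_lt continuous_const continuous_norm).inter (isOpen_lt continuous_norm continuous_const)
  have hys : y ∈ {z : E3 | ρ₁ < ‖z‖ ∧ ‖z‖ < ρ₂} := ⟨hy₁, hy₂⟩
  have hs0 : ∀ z ∈ {z : E3 | ρ₁ < ‖z‖ ∧ ‖z‖ < ρ₂}, z ≠ 0 := fun z hz h ↦ by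
    have h1 : ρ₁ < ‖z‖ := hz.1
    rw [h, norm_zero] at h1
    linarith
  have hC' : ∀ j ≤ k, ∀ z ∈ {z : E3 | ρ₁ < ‖z‖ ∧ ‖z‖ < ρ₂}, ‖iteratedFDeriv ℝ j φ z‖ ≤ C :=
    fun j hj z hz ↦ hC j hj z hz.1 hz.2
  have hφs : ContDiffOn ℝ k φ {z : E3 | ρ₁ < ‖z‖ ∧ ‖z‖ < ρ₂} :=
    (hφ.of_le (by exact_mod_cast le_top)).contDiffOn
  have hC0 : 0 ≤ C := (norm_nonneg _).trans (hC 0 (Nat.zero_le _) y hy₁ hy₂)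
  have hε0 : 0 ≤ ε := (norm_nonneg _).trans (hD₁ v w hv hw 0 (Nat.zero_le _) y hy₁ hy₂).1
  have hmono : (2 : ℝ) ^ i * (2 * C + 1) * ε ≤ 2 ^ k * (2 * C + 1) * ε :=
    mul_le_mul_of_nonneg_right
      (mul_le_mul_of_nonneg_right (pow_le_pow_right₀ one_le_two hi) (by linarith)) hε0
  refine ⟨?_, ?_⟩
  · have hfun : (fun z : E3 ↦ (D₁.interpolate D₂ hφ h01).h.inner z v w - gbarRep M r₀ z v w) =
        fun z ↦ φ z * D₁.h.inner z v w + (1 - φ z) * D₂.h.inner z v w - gbarRep M r₀ z v w := by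
      funext z
      rw [InitialDataSet.interpolate_h_inner_apply]
    rw [hfun]
    refine (norm_iteratedFDeriv_cutoff_interpolate_sub_le hs hφs
      ((contDiff_h_inner_apply D₁ v w).of_le (by exact_mod_cast le_top)).contDiffOn
      ((contDiff_h_inner_apply D₂ v w).of_le (by exact_mod_cast le_top)).contDiffOn
      (fun z hz ↦ (contDiffAt_gbarRep_apply M r₀ (hs0 z hz) v w).contDiffWithinAt) hC'
      (fun j hj z hz ↦ (hD₁ v w hv hw j hj z hz.1 hz.2).1)
      (fun j hj z hz ↦ (hD₂ v w hv hw j hj z hz.1 hz.2).1) hi hys).trans hmono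
  · have hfun : (fun z : E3 ↦ (D₁.interpolate D₂ hφ h01).k z v w - kbarRep M r₀ z v w) =
        fun z ↦ φ z * D₁.k z v w + (1 - φ z) * D₂.k z v w - kbarRep M r₀ z v w := by
      funext z
      rw [InitialDataSet.interpolate_k_apply]
    rw [hfun]
    refine (norm_iteratedFDeriv_cutoff_interpolate_sub_le hs hφs
      ((contDiff_k_apply D₁ v w).of_le (by exact_mod_cast le_top)).contDiffOn
      ((contDiff_k_apply D₂ v w).of_le (by exact_mod_cast le_top)).contDiffOn
      (fun z hz ↦ (contDiffAt_kbarRep_apply M r₀ (hs0 z hz) v w).contDiffWithinAt) hC'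
      (fun j hj z hz ↦ (hD₁ v w hv hw j hj z hz.1 hz.2).2)
      (fun j hj z hz ↦ (hD₂ v w hv hw j hj z hz.1 hz.2).2) hi hys).trans hmono

/-! ### The glued datum before deformation -/

omit [Kerr.Facts] in
/-- The radial cut-off takes values in `[0, 1]`. [folklore] -/
theorem radialCutoff_mem_Icc (σ₁ σ₂ : ℝ) (y : E3) :
    0 ≤ radialCutoff σ₁ σ₂ y ∧ radialCutoff σ₁ σ₂ y ≤ 1 :=
  ⟨radialCutoff_nonneg σ₁ σ₂ y, radialCutoff_le_one σ₁ σ₂ y⟩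

section PreGlued

variable {m a r₀ : ℝ} (ha : |a| < m) (h₁ : Kerr.rMinus m a < r₀) (h₂ : r₀ < Kerr.rPlus m a)
  (τ₀ : ℝ) (R : E3 →ₗᵢ[ℝ] E3) (σ₁ σ₂ : ℝ)

/-- **The glued datum before deformation** `D̃ = φ D + (1 − φ) D_{Kerr(m, a)}` of Li–Mei's proof of
Prop. 4.1 (p. 22, "`(g̃, π̃) = (φ ḡ + (1 − φ) ḡ_{m,a⃗}, φ π̄ + (1 − φ) π̄_{m,a⃗})`"), with the radial
cut-off `φ = radialCutoff σ₁ σ₂` (`= 1` on `{‖y‖ ≤ σ₁}`, `= 0` on `{σ₂ ≤ ‖y‖}`) and the global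
exact Kerr(`m, a`)-cylinder datum `kerrCylinderDatum` (`|a| < m`, `r₋ < r₀ < r₊`, time shift `τ₀`,
axis rotation `R`). [cite: LiMei2020, proof of Prop. 4.1, p. 22] -/
def preGluedDatum (D : InitialDataSet (𝓡 3) E3) : InitialDataSet (𝓡 3) E3 :=
  D.interpolate (kerrCylinderDatum ha h₁ h₂ τ₀ R) (contDiff_radialCutoff σ₁ σ₂)
    (radialCutoff_mem_Icc σ₁ σ₂)

variable {σ₁ σ₂}

/-- On `{‖y‖ ≤ σ₁}` the glued datum has the metric of `D` ("`= (ḡ, π̄)` near `t₁`").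
[cite: LiMei2020, proof of Prop. 4.1, p. 22] -/
theorem preGluedDatum_h_inner_of_norm_le (hσ₁ : 0 ≤ σ₁) (hσ : σ₁ < σ₂) (D : InitialDataSet (𝓡 3) E3)
    {y : E3} (hy : ‖y‖ ≤ σ₁) : (preGluedDatum ha h₁ h₂ τ₀ R σ₁ σ₂ D).h.inner y = D.h.inner y :=
  InitialDataSet.interpolate_h_inner_of_eq_one _ _ _ _ (radialCutoff_of_norm_le hσ₁ hσ hy)

/-- On `{‖y‖ ≤ σ₁}` the glued datum has the tensor `k` of `D`. [cite: LiMei2020, proof of Prop. 4.1, p. 22] -/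
theorem preGluedDatum_k_of_norm_le (hσ₁ : 0 ≤ σ₁) (hσ : σ₁ < σ₂) (D : InitialDataSet (𝓡 3) E3)
    {y : E3} (hy : ‖y‖ ≤ σ₁) : (preGluedDatum ha h₁ h₂ τ₀ R σ₁ σ₂ D).k y = D.k y :=
  InitialDataSet.interpolate_k_of_eq_one _ _ _ _ (radialCutoff_of_norm_le hσ₁ hσ hy)

/-- On `{σ₂ ≤ ‖y‖}` the glued datum has the metric of the Kerr-cylinder datum
("`= (ḡ_{m,a⃗}, π̄_{m,a⃗})` near `t₂`"). [cite: LiMei2020, proof of Prop. 4.1, p. 22] -/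
theorem preGluedDatum_h_inner_of_le_norm (hσ₁ : 0 ≤ σ₁) (hσ : σ₁ < σ₂) (D : InitialDataSet (𝓡 3) E3)
    {y : E3} (hy : σ₂ ≤ ‖y‖) :
    (preGluedDatum ha h₁ h₂ τ₀ R σ₁ σ₂ D).h.inner y = (kerrCylinderDatum ha h₁ h₂ τ₀ R).h.inner y :=
  InitialDataSet.interpolate_h_inner_of_eq_zero _ _ _ _ (radialCutoff_of_le_norm hσ₁ hσ hy)

/-- On `{σ₂ ≤ ‖y‖}` the glued datum has the tensor `k` of the Kerr-cylinder datum.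
[cite: LiMei2020, proof of Prop. 4.1, p. 22] -/
theorem preGluedDatum_k_of_le_norm (hσ₁ : 0 ≤ σ₁) (hσ : σ₁ < σ₂) (D : InitialDataSet (𝓡 3) E3)
    {y : E3} (hy : σ₂ ≤ ‖y‖) :
    (preGluedDatum ha h₁ h₂ τ₀ R σ₁ σ₂ D).k y = (kerrCylinderDatum ha h₁ h₂ τ₀ R).k y :=
  InitialDataSet.interpolate_k_of_eq_zero _ _ _ _ (radialCutoff_of_le_norm hσ₁ hσ hy)

/-- **The glued datum agrees with `D` on the ball `{‖y‖ < σ₁}`** (the clause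
`∀ y, ‖y‖ < σ₁ → D'.h.inner y = D.h.inner y ∧ D'.k y = D.k y` of the fact).
[cite: LiMei2020, proof of Prop. 4.1, p. 22] -/
theorem preGluedDatum_eq_of_norm_lt (hσ₁ : 0 ≤ σ₁) (hσ : σ₁ < σ₂) (D : InitialDataSet (𝓡 3) E3)
    (y : E3) (hy : ‖y‖ < σ₁) :
    (preGluedDatum ha h₁ h₂ τ₀ R σ₁ σ₂ D).h.inner y = D.h.inner y ∧
      (preGluedDatum ha h₁ h₂ τ₀ R σ₁ σ₂ D).k y = D.k y :=
  ⟨preGluedDatum_h_inner_of_norm_le ha h₁ h₂ τ₀ R hσ₁ hσ D hy.le,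
    preGluedDatum_k_of_norm_le ha h₁ h₂ τ₀ R hσ₁ hσ D hy.le⟩

/-- **The glued datum is exactly the Kerr(`m, a`) cylinder `{r = r₀}` on `{σ₂ ≤ ‖y‖}`** (`1 < σ₂`):
there it is the Kerr-cylinder datum, which is `IsKerrCylinderOn` on `{1 < ‖y‖}`
(`isKerrCylinderOn_kerrCylinderDatum`). [cite: LiMei2020, proof of Prop. 4.1, p. 22] -/
theorem isKerrCylinderOn_preGluedDatum (hσ₁ : 0 ≤ σ₁) (hσ : σ₁ < σ₂) (h1 : 1 < σ₂)
    (D : InitialDataSet (𝓡 3) E3) :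
    IsKerrCylinderOn m a r₀ τ₀ R {y : E3 | σ₂ ≤ ‖y‖} (preGluedDatum ha h₁ h₂ τ₀ R σ₁ σ₂ D) :=
  IsKerrCylinderOn.congr (fun _ hy ↦ preGluedDatum_h_inner_of_le_norm ha h₁ h₂ τ₀ R hσ₁ hσ D hy)
    (fun _ hy ↦ preGluedDatum_k_of_le_norm ha h₁ h₂ τ₀ R hσ₁ hσ D hy)
    (IsKerrCylinderOn.mono (fun _ hy ↦ lt_of_lt_of_le h1 hy)
      (isKerrCylinderOn_kerrCylinderDatum ha h₁ h₂ τ₀ R))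

/-- **The glued datum is vacuum where `D` is, inside the ball `{‖y‖ < σ₁}`**: for an open `s` on
which `D` solves the vacuum constraints, so does `D̃` on `s ∩ {‖y‖ < σ₁}` (locality).
[cite: LiMei2020, proof of Prop. 4.1, p. 22] -/
theorem isVacuumOn_preGluedDatum_of_norm_lt (hσ₁ : 0 ≤ σ₁) (hσ : σ₁ < σ₂) {s : Set E3}
    (hs : IsOpen s) {D : InitialDataSet (𝓡 3) E3} (hD : IsVacuumOn s D) :
    IsVacuumOn (s ∩ {y : E3 | ‖y‖ < σ₁}) (preGluedDatum ha h₁ h₂ τ₀ R σ₁ σ₂ D) :=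
  IsVacuumOn.congr (hs.inter (isOpen_lt continuous_norm continuous_const))
    (fun _ hy ↦ preGluedDatum_h_inner_of_norm_le ha h₁ h₂ τ₀ R hσ₁ hσ D (le_of_lt hy.2))
    (fun _ hy ↦ preGluedDatum_k_of_norm_le ha h₁ h₂ τ₀ R hσ₁ hσ D (le_of_lt hy.2))
    (hD.mono inter_subset_left)

/-- **The glued datum is vacuum on `{σ₂ < ‖y‖}`** (`1 ≤ σ₂`): there it is the Kerr-cylinder datum,
which is vacuum on `{1 < ‖y‖}` (`isVacuumOn_kerrCylinderDatum`). [cite: LiMei2020, proof of Prop. 4.1, p. 22] -/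
theorem isVacuumOn_preGluedDatum_of_lt_norm (hσ₁ : 0 ≤ σ₁) (hσ : σ₁ < σ₂) (h1 : 1 ≤ σ₂)
    (D : InitialDataSet (𝓡 3) E3) :
    IsVacuumOn {y : E3 | σ₂ < ‖y‖} (preGluedDatum ha h₁ h₂ τ₀ R σ₁ σ₂ D) :=
  IsVacuumOn.congr (isOpen_lt continuous_const continuous_norm)
    (fun _ hy ↦ preGluedDatum_h_inner_of_le_norm ha h₁ h₂ τ₀ R hσ₁ hσ D (le_of_lt hy))
    (fun _ hy ↦ preGluedDatum_k_of_le_norm ha h₁ h₂ τ₀ R hσ₁ hσ D (le_of_lt hy))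
    (IsVacuumOn.mono (fun _ hy ↦ lt_of_le_of_lt h1 hy) (isVacuumOn_kerrCylinderDatum ha h₁ h₂ τ₀ R))

/-- **The glued datum stays `Cε`-close to the Schwarzschild cylinder** ("`‖(g̃ − ḡ_{m₀}, π̃ − π̄_{m₀})‖
≤ Cε`", p. 22): there is a constant `C ≥ 0`, depending only on `σ₁, σ₂, ρ₁, ρ₂, k`, such that for
every `ε` and every datum `D` which is `ε`-close in `C^k` on `A = {ρ₁ < ‖y‖ < ρ₂}` to the
Schwarzschild(`M`) cylinder, if the Kerr(`m, a`)-cylinder datum is `ε`-close too, then `D̃` is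
`Cε`-close (`nearSchwarzschildCylinder_interpolate` with the derivative bounds of the radial cut-off
on the bounded annulus, `exists_bound_iteratedFDeriv`). [cite: LiMei2020, proof of Prop. 4.1, p. 22] -/
theorem nearSchwarzschildCylinder_preGluedDatum {M r₁ ρ₁ : ℝ} (hr₁ : r₁ < r₀) (h2M : r₀ < 2 * M)
    (hρ₁ : 1 ≤ ρ₁) (ρ₂ σ₁ σ₂ : ℝ) (k : ℕ) :
    ∃ C : ℝ, 0 ≤ C ∧ ∀ (ε : ℝ) (D : InitialDataSet (𝓡 3) E3),
      NearSchwarzschildCylinder M r₁ r₀ ρ₁ ρ₂ k ε D →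
      NearSchwarzschildCylinder M r₁ r₀ ρ₁ ρ₂ k ε (kerrCylinderDatum ha h₁ h₂ τ₀ R) →
      NearSchwarzschildCylinder M r₁ r₀ ρ₁ ρ₂ k (C * ε) (preGluedDatum ha h₁ h₂ τ₀ R σ₁ σ₂ D) := by
  have hr₀ : 0 < r₀ := pos_of_rMinus_lt ha h₁
  have hbdd : Bornology.IsBounded {z : E3 | ρ₁ < ‖z‖ ∧ ‖z‖ < ρ₂} :=
    Metric.isBounded_ball.subset fun z hz ↦ mem_ball_zero_iff.2 hz.2
  obtain ⟨C₀, hC₀⟩ := exists_bound_iteratedFDeriv (contDiff_radialCutoff (E := E3) σ₁ σ₂) hbdd k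
  have hC : ∀ j ≤ k, ∀ y : E3, ρ₁ < ‖y‖ → ‖y‖ < ρ₂ →
      ‖iteratedFDeriv ℝ j (radialCutoff σ₁ σ₂ : E3 → ℝ) y‖ ≤ max C₀ 0 := fun j hj y hy₁ hy₂ ↦
    (hC₀ j hj y ⟨hy₁, hy₂⟩).trans (le_max_left _ _)
  refine ⟨2 ^ k * (2 * max C₀ 0 + 1), by positivity, fun ε D hD hK ↦ ?_⟩
  exact nearSchwarzschildCylinder_interpolate hr₁ hr₀ h2M hρ₁ (contDiff_radialCutoff σ₁ σ₂)
    (radialCutoff_mem_Icc σ₁ σ₂) hC hD hK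

/-- **Assembly of the conclusion of Prop. 4.1 from the deformation step** (the last paragraph of
the printed proof, p. 25: "`(ḡ + h, π̄ + ω)` … is a vacuum datum which is `(ḡ, π̄)` near `t₁` and
exactly Kerr near `t₂`"). Fix radii `ρ₁ < s₁ < t₁ ≤ c₁ < c₂ ≤ t₂ < s₂`, `ρ₂` (`1 ≤ ρ₁`), a datum `D`
which is vacuum on `A = {ρ₁ < ‖y‖ < ρ₂}`, and admissible Kerr parameters; let `D̃` be the glued
datum with cut-off radii `c₁ < c₂`. If a datum `D'` — the output of the deformation on the middle
shell — agrees with `D̃` off the closed shell `{t₁ ≤ ‖y‖ ≤ t₂}` and solves the vacuum constraints on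
`{s₁ < ‖y‖ < s₂}`, then `D'` satisfies the last three clauses of the conclusion of
`LiMei.interiorKerrGluing`: it is `D` on the ball `{‖y‖ < s₁}`, vacuum on `A`, and exactly the
Kerr(`m, a`) cylinder on `{s₂ < ‖y‖ < ρ₂}` (locality of the constraints and the properties of `D̃`).
So the analytic core of the proof (Corvino–Schoen deformation with the cokernel absorbed by the
parameters, pp. 23–25) has to deliver exactly such a `D'`. [cite: LiMei2020, proof of Prop. 4.1, p. 25] -/
theorem conclusion_of_deformation {ρ₁ ρ₂ s₁ s₂ t₁ t₂ c₁ c₂ : ℝ} (hρ₁ : 1 ≤ ρ₁) (hs₁ : ρ₁ < s₁)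
    (ht₁ : s₁ < t₁) (hc₁ : t₁ ≤ c₁) (hc : c₁ < c₂) (hc₂ : c₂ ≤ t₂) (ht₂ : t₂ < s₂)
    {D : InitialDataSet (𝓡 3) E3} (hD : IsVacuumOn {y : E3 | ρ₁ < ‖y‖ ∧ ‖y‖ < ρ₂} D)
    {D' : InitialDataSet (𝓡 3) E3}
    (hagree : ∀ y : E3, (‖y‖ < t₁ ∨ t₂ < ‖y‖) →
      D'.h.inner y = (preGluedDatum ha h₁ h₂ τ₀ R c₁ c₂ D).h.inner y ∧
        D'.k y = (preGluedDatum ha h₁ h₂ τ₀ R c₁ c₂ D).k y)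
    (hvac : IsVacuumOn {y : E3 | s₁ < ‖y‖ ∧ ‖y‖ < s₂} D') :
    (∀ y : E3, ‖y‖ < s₁ → D'.h.inner y = D.h.inner y ∧ D'.k y = D.k y) ∧
      IsVacuumOn {y : E3 | ρ₁ < ‖y‖ ∧ ‖y‖ < ρ₂} D' ∧
      IsKerrCylinderOn m a r₀ τ₀ R {y : E3 | s₂ < ‖y‖ ∧ ‖y‖ < ρ₂} D' := by
  have hc₁0 : 0 ≤ c₁ := by linarith
  have h1c₂ : 1 < c₂ := by linarith
  refine ⟨fun y hy ↦ ?_, ?_, ?_⟩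
  · -- `D' = D̃ = D` on the ball `{‖y‖ < s₁}`
    obtain ⟨hh, hk⟩ := hagree y (Or.inl (by linarith))
    have hyc : ‖y‖ ≤ c₁ := by linarith
    exact ⟨hh.trans (preGluedDatum_h_inner_of_norm_le ha h₁ h₂ τ₀ R hc₁0 hc D hyc),
      hk.trans (preGluedDatum_k_of_norm_le ha h₁ h₂ τ₀ R hc₁0 hc D hyc)⟩
  · -- vacuum on `A`: three overlapping open pieces
    have hA : IsOpen {y : E3 | ρ₁ < ‖y‖ ∧ ‖y‖ < ρ₂} :=
      (isOpen_lt continuous_const continuous_norm).inter (isOpen_lt continuous_norm continuous_const)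
    have p1 : IsVacuumOn ({y : E3 | ρ₁ < ‖y‖ ∧ ‖y‖ < ρ₂} ∩ {y : E3 | ‖y‖ < t₁}) D' :=
      IsVacuumOn.congr (hA.inter (isOpen_lt continuous_norm continuous_const))
        (fun y hy ↦ (hagree y (Or.inl hy.2)).1) (fun y hy ↦ (hagree y (Or.inl hy.2)).2)
        (IsVacuumOn.mono (t := {y : E3 | ρ₁ < ‖y‖ ∧ ‖y‖ < ρ₂} ∩ {y : E3 | ‖y‖ < c₁})
          (fun y hy ↦ ⟨hy.1, lt_of_lt_of_le hy.2 hc₁⟩)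
          (isVacuumOn_preGluedDatum_of_norm_lt ha h₁ h₂ τ₀ R hc₁0 hc hA hD))
    have p3 : IsVacuumOn {y : E3 | t₂ < ‖y‖} D' :=
      IsVacuumOn.congr (isOpen_lt continuous_const continuous_norm)
        (fun y hy ↦ (hagree y (Or.inr hy)).1) (fun y hy ↦ (hagree y (Or.inr hy)).2)
        (IsVacuumOn.mono (fun y hy ↦ lt_of_le_of_lt hc₂ hy)
          (isVacuumOn_preGluedDatum_of_lt_norm ha h₁ h₂ τ₀ R hc₁0 hc h1c₂.le D))
    -- cover `A` by the three pieces, pointwise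
    intro inst y hy
    by_cases hy₁ : ‖y‖ < t₁
    · exact p1 y ⟨hy, hy₁⟩
    · by_cases hy₂ : t₂ < ‖y‖
      · exact p3 y hy₂
      · exact hvac y ⟨by linarith [not_lt.1 hy₁], by linarith [not_lt.1 hy₂]⟩
  · -- exactly Kerr on `{s₂ < ‖y‖ < ρ₂}`
    exact IsKerrCylinderOn.congr (fun y hy ↦ (hagree y (Or.inr (ht₂.trans hy.1))).1)
      (fun y hy ↦ (hagree y (Or.inr (ht₂.trans hy.1))).2)
      (IsKerrCylinderOn.mono (fun y hy ↦ (hc₂.trans ht₂.le).trans hy.1.le)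
        (isKerrCylinderOn_preGluedDatum ha h₁ h₂ τ₀ R hc₁0 hc h1c₂ D))

end PreGlued

end LiMei

end Literature.Geometry.Lorentzian

end
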